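import Summits.QuantumFields.BalabanUV.Beta.GAN24.SrecExitChargeLevelZero
import Summits.QuantumFields.BalabanUV.Beta.GAN24.SpureSlotChargeLevelZero
import Summits.QuantumFields.BalabanUV.Beta.GAN24.CubicPushFaceCharge
import Summits.QuantumFields.BalabanUV.Beta.GAN24.WardResidualRotatedVertexWeighted
import Summits.QuantumFields.BalabanUV.Beta.GAN24.GaugeReadChargeTransported

/-!
# `BalabanUV.Beta.GAN24.SpureSlotChargeLevelOne` — binder row G-an2-4 ∕ (CONV-C), the (S) row of RULING R-gan24p1-g27-1 B (viii), the PLAIN sub-row of (W-γ) one level up: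
# **THE PLAIN ff SLOT CHARGE OF THE PURE S TABLE AT LEVEL `j+1` IS THE ℋ-COLUMN READ OF THE LEVEL-`j` EXIT⊗EXIT SLOT-CHARGE FUNCTION; AT LEVEL 1 IT IS THE MAXWELL
# READ OF THE FACE FORM AGAINST THE ℋ-COLUMN OF `G_0`, AND VANISHES OUTRIGHT IN EVERY SAME-DIRECTION CHANNEL**
# (G-an2-4 formalisation swarm → CRUX TEAM (2), leaf prover `b2b-balaban-gan24-formalise-leaf-02`, gen 56, PART 3)

NOT IN PRINT; OUR BOOKKEEPING ([folklore] packaging BY NAME of: leaf-02 g52 `CubicPushFaceCharge.hasSum_prod_SpureRecAt_succ_inl_inl` (the ff pair total of the co-dressed cubic push =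
`Lc²σ_j²·` the two-face sum of its vertex), road-P2's weighted Fubini `WardResidualRotatedVertexWeighted.hasSum_weighted_vertexOfK`, leaf-02 g56 PART 1
`SpureSlotChargeLevelZero.tsum_prod_eq_tsum_tsum_swap` and PART 2 `SrecExitChargeLevelZero.tsum_exitFace_tsum_exitFace_srecAt_zero ∕ _self`, leaf-06's
`KernelLegCharges.summable_prod_of_biLoc` ∕ `GaugeReadChargeTransported.abs_faceWeight_le_one`, an2's `decays_coDressKBmAt_KInvStep`; 0 `def`, 0 cited fact, 0 `def … : Prop`, 0 sorry).  HONEST FRAMING (cell contract, verbatim):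
«discharging `BetaPertH` makes Bałaban's UV stability UNCONDITIONAL — a real constructive-QFT result; it is NOT the continuum limit and NOT the Clay problem.»  HONEST DEPENDENCY
(verbatim): «continuum YM on T⁴ ⇐ BetaPertH ∧ nine spine estimates (0/9 proved); BetaPertH ⇐ (D1) ∧ (D4) ∧ CAP+tail; G-an2-4 gates asym, D1 and NE2/3/4.»

SETTING.  Road-P2's `WardGammaPlainRowCentred` displays `hζS`: the plain pair charge `Σ'_{(x,z)} SpureRecAt … j κ′ u′ x z a b` is slot-constant.  PART 1 settled level `0`
(ff: `0`; fm: false); this PART is the level-`(j+1)` ff block.  `C^{exit}(T;κ,u;α,β) := Σ'_z 𝟙^{exit}_β(z)·Σ'_x 𝟙^{exit}_α(x)·T κ u x z (inl α)(inl β)` (PART 2's currency).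
* §1 `tsum_prod_exitPair_eq_iterated` (pair form = PART 2's iterated form, for a bi-localised table), and the GENERIC-LEVEL REDUCTION
  **`hasSum_prod_spureRecAt_succ_inl_inl_colH`**: `Σ'_{(x,z)} SpureRecAt … (j+1) κ′ u′ x z (inl α)(inl β) = (cE·wE_{j+1})·Lc²·σ_j²·Σ_κ Σ'_t colH G_j Lc κ′ u′ κ t · C^{exit}(SrecAt … j; κ,t;α,β)`
  — `hζS` at level `j+1` (ff) ⟺ the ℋ-COLUMN READ of the level-`j` exit⊗exit slot-charge function is slot-constant.
* §2 LEVEL 1: **`tsum_prod_spureRecAt_one_inl_inl_eq`** — with PART 2, `Σ'_{(x,z)} SpureRecAt … 1 κ′ u′ x z (inl α)(inl β)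
  = (cE·wE_1)·Lc²·σ_0²·Σ_κ Σ'_t colH G_0 Lc κ′ u′ κ t · (cE·(−¼·(curvAdj (curv m_αβ)) κ t))` — the MAXWELL READ of g55's face form `m_αβ` against the ℋ-column of
  `G_0 = coDressKBmAt ρ Lc (KInvStep Lc 0)`; and **`tsum_prod_spureRecAt_one_inl_inl_self`** ∕ **`hasSum_prod_spureRecAt_one_inl_inl_self`**: in EVERY same-direction channel `(α,α)`
  the level-1 plain ff slot charge is `0` at every slot — `hζS` at `j = 1`, `(inl α, inl α)`, `ζS = 0`, UNCONDITIONALLY.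
NOT HERE (PART 4, after leaf-06 g46's `RelInvWardPairing` lands): the cross-direction channels, where the displayed Maxwell read unfolds through the Euler–Lagrange rows of the
bordered Hessian (`ward_pairing_coDressKBmAt_KInvStep_zero` at the identity source, hard-axial representative of leaf-06's bounded potential) into the block contour sums of a
periodic 1-form against the mm column totals of `K_0` — zero by leaf-06's `MultiplierZeroMass` (PREDICTION P-leaf02-g56-1: `ζS = 0` at level 1 in every ff channel).
Asserts NO value of any column of `G_0`; NOTHING of (W-γ) ∕ (T-F) ∕ (INV) ∕ (S) ∕ (Q-R) ∕ (LT) ∕ (Q-L) ∕ (C) ∕ «T2Shape» ∕ (hW, hWall) discharged; NEVER «G-an2-4 closed» as (CONV-C);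
NOT D1, NOT `BetaPertH`, NOT continuum, NOT Clay.  2026-08-22; no existing file touched.
-/

noncomputable section

open Finset
open scoped BigOperators
open Literature.MathematicalPhysics.QuantumFieldTheory
open Literature.MathematicalPhysics.QuantumFieldTheory.Balaban1983to89
open Literature.MathematicalPhysics.QuantumFieldTheory.Balaban1983to89.Beta
open B12Sec2to5 (l1)
open ExpKernelCalculus (Site MKer BiLoc Decays)
open OneStepResolventKernel (Fib LocStencil)
open OneStepKernelFamily (KInvStep colH abs_colH_le vertexOfK)
open AffineAveraging (box toSite dz curv curvAdj)
open BalabanStepJetsSucc (wE)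
open Summit.QuantumFields.BalabanUV.Beta.AxialDressingRooted (coDressKBmAt decays_coDressKBmAt_KInvStep)
open Summit.QuantumFields.BalabanUV.Beta.SpineRooted (SpureRecAt)
open Summit.QuantumFields.BalabanUV.Beta.WardLocusRecursive (SrecAt locStencil_SrecAt)
open Summit.QuantumFields.BalabanUV.Beta.GAN24.KernelLegCharges (summable_prod_of_biLoc)
open Summit.QuantumFields.BalabanUV.Beta.GAN24.CubicPushFaceCharge (hasSum_prod_SpureRecAt_succ_inl_inl)
open Summit.QuantumFields.BalabanUV.Beta.GAN24.WardResidualRotatedVertexWeighted (hasSum_weighted_vertexOfK)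
open Summit.QuantumFields.BalabanUV.Beta.GAN24.GaugeReadChargeTransported (abs_faceWeight_le_one)
open Summit.QuantumFields.BalabanUV.Beta.GAN24.SpureSlotChargeLevelZero (tsum_prod_eq_tsum_tsum_swap)
open Summit.QuantumFields.BalabanUV.Beta.GAN24.SrecExitChargeLevelZero (tsum_exitFace_tsum_exitFace_srecAt_zero tsum_exitFace_tsum_exitFace_srecAt_zero_self)

namespace Summit.QuantumFields.BalabanUV.Beta.GAN24.SpureSlotChargeLevelOne

variable {d : ℕ}

/-! ## §1 The generic-level reduction: the plain ff slot charge at level `j+1` is the ℋ-column read of the level-`j` exit⊗exit slot charges -/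

/-- [folklore] The masked entry is the product of the two exit indicators times the entry. -/
theorem exitPair_ite_eq_mul (L : ℕ) (α β : Fin (d + 1)) (x z : Site (d + 1)) (v : ℝ) :
    (if x α % (L : ℤ) = (L : ℤ) - 1 ∧ z β % (L : ℤ) = (L : ℤ) - 1 then v else 0)
      = (if z β % (L : ℤ) = (L : ℤ) - 1 then (1 : ℝ) else 0) * ((if x α % (L : ℤ) = (L : ℤ) - 1 then (1 : ℝ) else 0) * v) := by
  by_cases h1 : x α % (L : ℤ) = (L : ℤ) - 1 <;> by_cases h2 : z β % (L : ℤ) = (L : ℤ) - 1 <;> simp [h1, h2]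

/-- [folklore] **PAIR FORM = ITERATED FORM** for the exit⊗exit slot charge of a bi-localised table entry (rate `δ > 0`):
`Σ'_{(x,z)} [x_α, z_β exit]·T x z (inl α)(inl β) = Σ'_z 𝟙^{exit}_β(z)·Σ'_x 𝟙^{exit}_α(x)·T x z (inl α)(inl β)` (PART 2's currency). -/
theorem tsum_prod_exitPair_eq_iterated {L : ℕ} {T : MKer (d + 1) (Fib d)} {p : Site (d + 1)} {C δ : ℝ} (hT : BiLoc T p p C δ) (hδ : 0 < δ)
    (α β : Fin (d + 1)) :
    ∑' xz : Site (d + 1) × Site (d + 1), (if xz.1 α % (L : ℤ) = (L : ℤ) - 1 ∧ xz.2 β % (L : ℤ) = (L : ℤ) - 1 then T xz.1 xz.2 (Sum.inl α) (Sum.inl β) else 0)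
      = ∑' z, (if z β % (L : ℤ) = (L : ℤ) - 1 then (1 : ℝ) else 0) *
          ∑' x, (if x α % (L : ℤ) = (L : ℤ) - 1 then (1 : ℝ) else 0) * T x z (Sum.inl α) (Sum.inl β) := by
  have hs : Summable fun xz : Site (d + 1) × Site (d + 1) => T xz.1 xz.2 (Sum.inl α) (Sum.inl β) := summable_prod_of_biLoc hT hδ _ _
  have hm : Summable fun xz : Site (d + 1) × Site (d + 1) =>
      (if xz.2 β % (L : ℤ) = (L : ℤ) - 1 then (1 : ℝ) else 0) * ((if xz.1 α % (L : ℤ) = (L : ℤ) - 1 then (1 : ℝ) else 0) * T xz.1 xz.2 (Sum.inl α) (Sum.inl β)) := by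
    refine Summable.of_norm_bounded hs.abs (fun xz => ?_)
    rw [Real.norm_eq_abs, abs_mul, abs_mul]
    have h1 : |(if xz.2 β % (L : ℤ) = (L : ℤ) - 1 then (1 : ℝ) else 0)| ≤ 1 := by split_ifs <;> simp
    have h2 : |(if xz.1 α % (L : ℤ) = (L : ℤ) - 1 then (1 : ℝ) else 0)| ≤ 1 := by split_ifs <;> simp
    have h3 := abs_nonneg (T xz.1 xz.2 (Sum.inl α) (Sum.inl β))
    calc _ ≤ 1 * (1 * |T xz.1 xz.2 (Sum.inl α) (Sum.inl β)|) := by gcongr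
      _ = _ := by ring
  simp only [exitPair_ite_eq_mul]
  rw [tsum_prod_eq_tsum_tsum_swap (F := fun x z => (if z β % (L : ℤ) = (L : ℤ) - 1 then (1 : ℝ) else 0)
      * ((if x α % (L : ℤ) = (L : ℤ) - 1 then (1 : ℝ) else 0) * T x z (Sum.inl α) (Sum.inl β))) hm]
  refine tsum_congr fun z => ?_
  rw [tsum_mul_left]

/-- NOT IN PRINT; OUR BOOKKEEPING.  **THE GENERIC-LEVEL REDUCTION** (in-block root `ρ = toSite r`, `Lc ≥ 1`, every `j`, every `cE cVH cΛ`, slot `(κ′,u′)`, ff channel `(α,β)`):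
`HasSum ((x,z) ↦ SpureRecAt … (j+1) κ′ u′ x z (inl α)(inl β)) ((cE·wE_{j+1})·Lc²·σ_j²·Σ_κ Σ'_t colH G_j Lc κ′ u′ κ t · C^{exit}(SrecAt … j; κ,t;α,β))`,
`G_j = coDressKBmAt ρ Lc (KInvStep Lc j)`, `σ_j = ((Lc^{j+1})^{d+2})⁻¹` — leaf-02 g52's two-face total + road-P2's weighted Fubini through the chain-rule vertex + §1's pair∕iterated bridge.
So `hζS` at level `j+1` on the ff block says: the ℋ-COLUMN READ `(κ′,u′) ↦ Σ_κ Σ'_t colH G_j Lc κ′ u′ κ t·C^{exit}_j(κ,t)` of the previous member's exit⊗exit slot-charge function is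
slot-constant. -/
theorem hasSum_prod_spureRecAt_succ_inl_inl_colH {Lc : ℕ} [NeZero Lc] {r : Fin (d + 1) → ℕ} (hr : r ∈ box (d + 1) Lc) (cE cVH cΛ : ℝ) (j : ℕ)
    (κ' : Fin (d + 1)) (u' : Site (d + 1)) (α β : Fin (d + 1)) :
    HasSum (fun xz : Site (d + 1) × Site (d + 1) => SpureRecAt d Lc (toSite r) cE cVH cΛ (j + 1) κ' u' xz.1 xz.2 (Sum.inl α) (Sum.inl β))
      ((cE * wE d Lc (j + 1)) * ((Lc : ℝ) ^ 2 * (((((Lc ^ (j + 1) : ℕ) : ℝ)) ^ (d + 1 + 1))⁻¹) ^ 2 *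
        ∑ κ : Fin (d + 1), ∑' t : Site (d + 1), colH (coDressKBmAt (toSite r) Lc (KInvStep (d := d) Lc j)) Lc κ' u' κ t *
          ∑' z, (if z β % (Lc : ℤ) = (Lc : ℤ) - 1 then (1 : ℝ) else 0) *
            ∑' x, (if x α % (Lc : ℤ) = (Lc : ℤ) - 1 then (1 : ℝ) else 0) * SrecAt d Lc (toSite r) cE cVH cΛ j κ t x z (Sum.inl α) (Sum.inl β))) := by
  have hLc : 1 ≤ Lc := Nat.one_le_iff_ne_zero.2 (NeZero.ne Lc)
  have h := hasSum_prod_SpureRecAt_succ_inl_inl hr cE cVH cΛ j κ' u' α β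
  -- the column bound of `G_j` and the locality of `SrecAt j`
  obtain ⟨δ, C, hδ, -, hG⟩ := decays_coDressKBmAt_KInvStep (d := d) hr j
  obtain ⟨Cs, δs, hδs, hS⟩ := locStencil_SrecAt (d := d) (Lc := Lc) hLc hr cE cVH cΛ j
  have hw : ∀ (κ : Fin (d + 1)) (t : Site (d + 1)),
      |colH (coDressKBmAt (toSite r) Lc (KInvStep (d := d) Lc j)) Lc κ' u' κ t| ≤ C * Real.exp (-δ * l1 (t - (Lc : ℤ) • u')) :=
    fun κ t => abs_colH_le hG κ' u' κ t
  have hF := (hasSum_weighted_vertexOfK (N := Lc) κ' u' hw hδ hS hδs (Sum.inl α) (Sum.inl β)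
    (ω := fun xz : Site (d + 1) × Site (d + 1) => (if xz.1 α % (Lc : ℤ) = (Lc : ℤ) - 1 ∧ xz.2 β % (Lc : ℤ) = (Lc : ℤ) - 1 then (1 : ℝ) else 0))
    (B := 1) (abs_faceWeight_le_one Lc α β)).1
  -- the two-face sum in the value of `h` is the weighted pair sum of the vertex
  have e1 : (∑' yw : Site (d + 1) × Site (d + 1),
        (if yw.1 α % (Lc : ℤ) = (Lc : ℤ) - 1 ∧ yw.2 β % (Lc : ℤ) = (Lc : ℤ) - 1 then
          vertexOfK (coDressKBmAt (toSite r) Lc (KInvStep (d := d) Lc j)) Lc (SrecAt d Lc (toSite r) cE cVH cΛ j) κ' u' yw.1 yw.2 (Sum.inl α) (Sum.inl β) else 0))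
      = ∑ κ : Fin (d + 1), ∑' t : Site (d + 1), colH (coDressKBmAt (toSite r) Lc (KInvStep (d := d) Lc j)) Lc κ' u' κ t *
          ∑' xz : Site (d + 1) × Site (d + 1), (if xz.1 α % (Lc : ℤ) = (Lc : ℤ) - 1 ∧ xz.2 β % (Lc : ℤ) = (Lc : ℤ) - 1 then (1 : ℝ) else 0)
            * SrecAt d Lc (toSite r) cE cVH cΛ j κ t xz.1 xz.2 (Sum.inl α) (Sum.inl β) := by
    rw [← hF.tsum_eq]
    refine tsum_congr fun yw => ?_
    split_ifs <;> simp
  -- each masked pair sum of the table is its iterated exit⊗exit slot charge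
  have e2 : ∀ (κ : Fin (d + 1)) (t : Site (d + 1)),
      (∑' xz : Site (d + 1) × Site (d + 1), (if xz.1 α % (Lc : ℤ) = (Lc : ℤ) - 1 ∧ xz.2 β % (Lc : ℤ) = (Lc : ℤ) - 1 then (1 : ℝ) else 0)
          * SrecAt d Lc (toSite r) cE cVH cΛ j κ t xz.1 xz.2 (Sum.inl α) (Sum.inl β))
        = ∑' z, (if z β % (Lc : ℤ) = (Lc : ℤ) - 1 then (1 : ℝ) else 0) *
            ∑' x, (if x α % (Lc : ℤ) = (Lc : ℤ) - 1 then (1 : ℝ) else 0) * SrecAt d Lc (toSite r) cE cVH cΛ j κ t x z (Sum.inl α) (Sum.inl β) := by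
    intro κ t
    rw [← tsum_prod_exitPair_eq_iterated (hS κ t) hδs α β]
    refine tsum_congr fun xz => ?_
    split_ifs <;> simp
  simp only [e2] at e1
  rw [e1] at h
  exact h

/-- NOT IN PRINT; OUR BOOKKEEPING.  The `tsum` form of the generic-level reduction. -/
theorem tsum_prod_spureRecAt_succ_inl_inl_colH {Lc : ℕ} [NeZero Lc] {r : Fin (d + 1) → ℕ} (hr : r ∈ box (d + 1) Lc) (cE cVH cΛ : ℝ) (j : ℕ)
    (κ' : Fin (d + 1)) (u' : Site (d + 1)) (α β : Fin (d + 1)) :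
    ∑' xz : Site (d + 1) × Site (d + 1), SpureRecAt d Lc (toSite r) cE cVH cΛ (j + 1) κ' u' xz.1 xz.2 (Sum.inl α) (Sum.inl β)
      = (cE * wE d Lc (j + 1)) * ((Lc : ℝ) ^ 2 * (((((Lc ^ (j + 1) : ℕ) : ℝ)) ^ (d + 1 + 1))⁻¹) ^ 2 *
        ∑ κ : Fin (d + 1), ∑' t : Site (d + 1), colH (coDressKBmAt (toSite r) Lc (KInvStep (d := d) Lc j)) Lc κ' u' κ t *
          ∑' z, (if z β % (Lc : ℤ) = (Lc : ℤ) - 1 then (1 : ℝ) else 0) *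
            ∑' x, (if x α % (Lc : ℤ) = (Lc : ℤ) - 1 then (1 : ℝ) else 0) * SrecAt d Lc (toSite r) cE cVH cΛ j κ t x z (Sum.inl α) (Sum.inl β)) :=
  (hasSum_prod_spureRecAt_succ_inl_inl_colH hr cE cVH cΛ j κ' u' α β).tsum_eq

/-! ## §2 Level 1: the Maxwell read of the face form against the ℋ-column of `G_0`; the same-direction channels vanish -/

/-- NOT IN PRINT; OUR BOOKKEEPING.  **THE LEVEL-1 PLAIN ff SLOT CHARGE OF THE PURE S TABLE** (in-block root, `Lc ≥ 1`, every `cE cVH cΛ`, slot `(κ′,u′)`, channel `(α,β)`):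
`Σ'_{(x,z)} SpureRecAt … 1 κ′ u′ x z (inl α)(inl β) = (cE·wE_1)·Lc²·σ_0²·Σ_κ Σ'_t colH G_0 Lc κ′ u′ κ t · (cE·(−¼·(curvAdj (curv m_αβ)) κ t))` with g55's face form
`m_αβ β′ z := dzψ_β β′ z·(ψ_α z + ψ_α(z+e_{β′}))`, `ψ_c = ⌊·_c∕Lc⌋` — PART 2's exit⊗exit slot-charge function inside §1.  The Λ-letter and the border table contribute NOTHING; what is
left is the `(d*d)`-image of the face form read against the ℋ-COLUMN `t ↦ G_0 t (Lc•u′) (inl κ)(inr κ′)` — the left side of leaf-06's relative-inverse Ward pairing. -/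
theorem tsum_prod_spureRecAt_one_inl_inl_eq {Lc : ℕ} [NeZero Lc] {r : Fin (d + 1) → ℕ} (hr : r ∈ box (d + 1) Lc) (cE cVH cΛ : ℝ)
    (κ' : Fin (d + 1)) (u' : Site (d + 1)) (α β : Fin (d + 1)) :
    ∑' xz : Site (d + 1) × Site (d + 1), SpureRecAt d Lc (toSite r) cE cVH cΛ 1 κ' u' xz.1 xz.2 (Sum.inl α) (Sum.inl β)
      = (cE * wE d Lc 1) * ((Lc : ℝ) ^ 2 * (((((Lc ^ 1 : ℕ) : ℝ)) ^ (d + 1 + 1))⁻¹) ^ 2 *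
        ∑ κ : Fin (d + 1), ∑' t : Site (d + 1), colH (coDressKBmAt (toSite r) Lc (KInvStep (d := d) Lc 0)) Lc κ' u' κ t *
          (cE * (-(1 / 4 : ℝ) * curvAdj (curv (fun β' z => dz (fun w : Fin (d + 1) → ℤ => ((w β / (Lc : ℤ) : ℤ) : ℝ)) β' z
            * ((((z α / (Lc : ℤ) : ℤ) : ℝ)) + (((z + B6BondElimination.unitVec β') α / (Lc : ℤ) : ℤ) : ℝ)))) κ t))) := by
  have hLc : 1 ≤ Lc := Nat.one_le_iff_ne_zero.2 (NeZero.ne Lc)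
  rw [tsum_prod_spureRecAt_succ_inl_inl_colH hr cE cVH cΛ 0 κ' u' α β]
  simp only [tsum_exitFace_tsum_exitFace_srecAt_zero hLc hr]

/-- NOT IN PRINT; OUR BOOKKEEPING.  **`hζS` AT LEVEL 1 IN EVERY SAME-DIRECTION ff CHANNEL, WITH `ζS = 0`**: for an in-block root, every `cE cVH cΛ`, every slot `(κ′,u′)` and every `α`,
`Σ'_{(x,z)} SpureRecAt d Lc ρ cE cVH cΛ 1 κ′ u′ x z (inl α)(inl α) = 0` — the level-0 exit⊗exit slot-charge function vanishes identically in the channel `(α,α)` (PART 2 `…_self`),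
so its ℋ-column read does too.  No hypothesis on `Lc`, the root, or the pins. -/
theorem tsum_prod_spureRecAt_one_inl_inl_self {Lc : ℕ} [NeZero Lc] {r : Fin (d + 1) → ℕ} (hr : r ∈ box (d + 1) Lc) (cE cVH cΛ : ℝ)
    (κ' : Fin (d + 1)) (u' : Site (d + 1)) (α : Fin (d + 1)) :
    ∑' xz : Site (d + 1) × Site (d + 1), SpureRecAt d Lc (toSite r) cE cVH cΛ 1 κ' u' xz.1 xz.2 (Sum.inl α) (Sum.inl α) = 0 := by
  have hLc : 1 ≤ Lc := Nat.one_le_iff_ne_zero.2 (NeZero.ne Lc)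
  rw [tsum_prod_spureRecAt_succ_inl_inl_colH hr cE cVH cΛ 0 κ' u' α α]
  simp only [tsum_exitFace_tsum_exitFace_srecAt_zero_self hLc hr, mul_zero, tsum_zero, Finset.sum_const_zero]

/-- NOT IN PRINT; OUR BOOKKEEPING.  The `HasSum` form: road-P2's `hζS` at `j = 1`, channel `(inl α, inl α)`, value `0`. -/
theorem hasSum_prod_spureRecAt_one_inl_inl_self {Lc : ℕ} [NeZero Lc] {r : Fin (d + 1) → ℕ} (hr : r ∈ box (d + 1) Lc) (cE cVH cΛ : ℝ)
    (κ' : Fin (d + 1)) (u' : Site (d + 1)) (α : Fin (d + 1)) :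
    HasSum (fun xz : Site (d + 1) × Site (d + 1) => SpureRecAt d Lc (toSite r) cE cVH cΛ 1 κ' u' xz.1 xz.2 (Sum.inl α) (Sum.inl α)) 0 := by
  rw [← tsum_prod_spureRecAt_one_inl_inl_self hr cE cVH cΛ κ' u' α]
  exact (hasSum_prod_spureRecAt_succ_inl_inl_colH hr cE cVH cΛ 0 κ' u' α α).summable.hasSum

end Summit.QuantumFields.BalabanUV.Beta.GAN24.SpureSlotChargeLevelOne

end
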